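import Mathlib

/-!
# Square-difference-free sets in `ℤ[√-2]` of exponent `3/4` (base-`3` digits, `3` split, a Sperner pair code)

Twin of `…GaussLiftDigits.lean` (wall-breaker seat k2/12, stub `stub_tangencySets` of the crux
`LevelOneGL2Designs`, stmt-MatrixMultiplication-14080) with `ℤ[i]` replaced by `ℤ[√-2]`: the input of the
`√-2`-parabola lift (`…SqrtNegTwoLift.lean`), which extends the new exponent `5/4` for strong
representative systems of `AG(2,p)` from the primes `p ≡ 1 (mod 4)` to the primes `p ≡ 3 (mod 8)`
(those with `-2` a square).

Encode `a + b√-2` (`a, b ≥ 0`) as `(a, b) : ℕ × ℕ`; the square of `c + d√-2` is `(c² - 2d², 2cd)`.  Here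
`3 = (1 + √-2)(1 - √-2)` SPLITS, `ℤ[√-2]/(3) ≅ 𝔽₃ × 𝔽₃` with `√-2 ↦ (1, 2)`, and the digits at even
positions are taken from `R = √-2·{0,1,2} = {(0,0),(0,1),(0,2)}`, whose images `{(0,0),(1,2),(2,1)}` form
a Sperner family of the cyclic triangle: every ordered difference has a coordinate equal to the
non-square `2` of `𝔽₃`.  Concretely (`sqrtNegTwoSq_mod_three`): a square `(c² - 2d², 2cd)` with first
coordinate `≡ 0 (mod 3)` has `3 ∣ c` and `3 ∣ d` (the form `c² - 2d² ≡ c² + d²` is anisotropic mod `3`),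
hence second coordinate `≡ 0` as well — so it is never `≡ (0, ±1)`, the differences of `R`.

* `exists_sqrtNegTwoSqDiffFree` — for every `t`, a set `K ⊆ [0,9^t)²` with `|K| = 27^t` no two of whose
  elements differ by the square of an element of `ℤ[√-2]`.

Elementary; no definitions.  See `NumberRingLift.md` of the seat (evidence on the item).
-/

-- justification: the summit/problem path `MatrixMultiplication.MatrixMultiplication` is fixed by the
-- tree layout (D-0017), so the namespace necessarily repeats a component.
set_option linter.dupNamespace false

namespace Summit.MatrixMultiplication.MatrixMultiplication.Theorems.LevelOneGL2Designs.ParabolaLift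

open Finset

/-- **Squares of `ℤ[√-2]` mod `3`.**  If the first coordinate `c² - 2d²` of the square of `c + d√-2`
vanishes mod `3` then `c ≡ d ≡ 0 (mod 3)` (the form is `≡ c² + d²`, anisotropic over `𝔽₃`). [elementary] -/
theorem sqrtNegTwoSq_mod_three (c d : ZMod 3) (h : c ^ 2 - 2 * d ^ 2 = 0) : c = 0 ∧ d = 0 := by
  revert c d
  decide

/-- **One base-`3` double-digit step in `ℤ[√-2]`.**  If no two elements of `K ⊆ [0,W)²` differ by a square
of `ℤ[√-2]`, the same holds for `{r + 3e + 9k : r ∈ {(0,0),(0,1),(0,2)}, e ∈ {0,1,2}², k ∈ K} ⊆ [0, 9W)²`,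
which has `27·|K|` elements. [elementary; Ruzsa 1984, §2, run in `ℤ[√-2]` with the split prime `3`] -/
theorem sqrtNegTwoSqDiffFree_step (W : ℕ) (K : Finset (ℕ × ℕ)) (hKW : ∀ k ∈ K, k.1 < W ∧ k.2 < W)
    (hK : ∀ k ∈ K, ∀ k' ∈ K, ∀ c d : ℤ, (k.1 : ℤ) - k'.1 = c ^ 2 - 2 * d ^ 2 →
      (k.2 : ℤ) - k'.2 = 2 * c * d → c = 0 ∧ d = 0) :
    ∃ K' : Finset (ℕ × ℕ), K'.card = 27 * K.card ∧ (∀ k ∈ K', k.1 < 9 * W ∧ k.2 < 9 * W) ∧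
      ∀ k ∈ K', ∀ k' ∈ K', ∀ c d : ℤ, (k.1 : ℤ) - k'.1 = c ^ 2 - 2 * d ^ 2 →
        (k.2 : ℤ) - k'.2 = 2 * c * d → c = 0 ∧ d = 0 := by
  classical
  -- the digit data `(ρ, (e₁, e₂), (k₁, k₂)) ↦ (3 e₁ + 9 k₁, ρ + 3 e₂ + 9 k₂)`, `ρ ∈ {0,1,2}` being the
  -- second coordinate of the `R`-digit `(0, ρ) = ρ·√-2`
  have hinj : Set.InjOn (fun x : ℕ × (ℕ × ℕ) × (ℕ × ℕ) =>
      (3 * x.2.1.1 + 9 * x.2.2.1, x.1 + 3 * x.2.1.2 + 9 * x.2.2.2))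
      ↑((range 3) ×ˢ ((range 3 ×ˢ range 3) ×ˢ K)) := by
    rintro ⟨ρ, ⟨e₁, e₂⟩, ⟨k₁, k₂⟩⟩ h ⟨ρ', ⟨e₁', e₂'⟩, ⟨k₁', k₂'⟩⟩ h' heq
    simp only [coe_product, coe_range, Set.mem_prod, Set.mem_Iio, mem_coe] at h h'
    simp only [Prod.mk.injEq] at heq
    obtain ⟨hq1, hq2⟩ := heq
    have hρ : ρ = ρ' := by omega
    subst hρ
    have he1 : e₁ = e₁' := by omega
    have he2 : e₂ = e₂' := by omega
    subst he1
    subst he2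
    have hk1 : k₁ = k₁' := by omega
    have hk2 : k₂ = k₂' := by omega
    subst hk1
    subst hk2
    rfl
  refine ⟨((range 3) ×ˢ ((range 3 ×ˢ range 3) ×ˢ K)).image fun x : ℕ × (ℕ × ℕ) × (ℕ × ℕ) =>
      (3 * x.2.1.1 + 9 * x.2.2.1, x.1 + 3 * x.2.1.2 + 9 * x.2.2.2), ?_, ?_, ?_⟩
  · rw [card_image_of_injOn hinj, card_product, card_product, card_product, card_range]
    ring
  · -- the box
    intro n hn
    simp only [mem_image, mem_product, mem_range, Prod.exists] at hn
    obtain ⟨ρ, e₁, e₂, k₁, k₂, ⟨hρ, ⟨he₁, he₂⟩, hk⟩, rfl⟩ := hn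
    have := hKW _ hk
    dsimp only at this ⊢
    constructor <;> omega
  · -- square-difference-freeness
    intro n hn n' hn' c d h1 h2
    simp only [mem_image, mem_product, mem_range, Prod.exists] at hn hn'
    obtain ⟨ρ, e₁, e₂, k₁, k₂, ⟨hρ, ⟨he₁, he₂⟩, hk⟩, rfl⟩ := hn
    obtain ⟨ρ', e₁', e₂', k₁', k₂', ⟨hρ', ⟨he₁', he₂'⟩, hk'⟩, rfl⟩ := hn'
    dsimp only at h1 h2
    push_cast at h1 h2
    -- reduce mod 3: `c² - d² ≡ ρ - ρ' ≡ 2cd`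
    have q1 := congrArg (Int.cast : ℤ → ZMod 3) h1
    have q2 := congrArg (Int.cast : ℤ → ZMod 3) h2
    push_cast at q1 q2
    rw [show (3 : ZMod 3) = 0 by decide, show (9 : ZMod 3) = 0 by decide] at q1 q2
    simp only [zero_mul, add_zero, sub_self] at q1 q2
    -- `q1 : 0 = c² - 2d²`, `q2 : ρ - ρ' = 2cd` (mod 3)
    obtain ⟨hc3, hd3⟩ := sqrtNegTwoSq_mod_three (c : ZMod 3) (d : ZMod 3) q1.symm
    -- hence `ρ = ρ'`
    have hρρ : ρ = ρ' := by
      have h0 : (((ρ : ℤ) - ρ' : ℤ) : ZMod 3) = 0 := by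
        push_cast
        rw [q2, hc3, hd3]
        ring
      have h3 := (ZMod.intCast_zmod_eq_zero_iff_dvd _ 3).mp h0
      omega
    subst hρρ
    -- and `3 ∣ c`, `3 ∣ d`, so `9` divides the square
    obtain ⟨c₁, rfl⟩ := (ZMod.intCast_zmod_eq_zero_iff_dvd c 3).mp hc3
    obtain ⟨d₁, rfl⟩ := (ZMod.intCast_zmod_eq_zero_iff_dvd d 3).mp hd3
    push_cast at h1 h2
    obtain ⟨C, hC⟩ : ∃ C : ℤ, C = c₁ ^ 2 - 2 * d₁ ^ 2 := ⟨_, rfl⟩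
    obtain ⟨P, hP⟩ : ∃ P : ℤ, P = c₁ * d₁ := ⟨_, rfl⟩
    have h1' : 3 * ((e₁ : ℤ) - e₁') + 9 * ((k₁ : ℤ) - k₁') = 9 * C := by
      rw [hC]; linear_combination h1
    have h2' : 3 * ((e₂ : ℤ) - e₂') + 9 * ((k₂ : ℤ) - k₂') = 9 * (2 * P) := by
      rw [hP]; linear_combination h2
    have hee1 : e₁ = e₁' := by omega
    have hee2 : e₂ = e₂' := by omega
    subst hee1
    subst hee2
    -- divide by `9` and use the hypothesis on `K`
    have hk1 : ((k₁ : ℕ) : ℤ) - (k₁' : ℕ) = c₁ ^ 2 - 2 * d₁ ^ 2 := by rw [← hC]; linarith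
    have hk2 : ((k₂ : ℕ) : ℤ) - (k₂' : ℕ) = 2 * c₁ * d₁ := by rw [mul_assoc, ← hP]; linarith
    obtain ⟨hc0, hd0⟩ := hK _ hk _ hk' c₁ d₁ hk1 hk2
    subst hc0
    subst hd0
    simp

/-- **Square-difference-free sets of exponent `3/4` in `ℤ[√-2]`.**  For every `t` there is
`K ⊆ [0, 9^t)² ⊆ ℤ[√-2]` with `|K| = 27^t = (81^t)^{3/4}` no two of whose elements differ by the square
of an element of `ℤ[√-2]`. [elementary; new] -/
theorem exists_sqrtNegTwoSqDiffFree (t : ℕ) :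
    ∃ K : Finset (ℕ × ℕ), K.card = 27 ^ t ∧ (∀ k ∈ K, k.1 < 9 ^ t ∧ k.2 < 9 ^ t) ∧
      ∀ k ∈ K, ∀ k' ∈ K, ∀ c d : ℤ, (k.1 : ℤ) - k'.1 = c ^ 2 - 2 * d ^ 2 →
        (k.2 : ℤ) - k'.2 = 2 * c * d → c = 0 ∧ d = 0 := by
  classical
  induction t with
  | zero =>
    refine ⟨{(0, 0)}, by simp, by simp, ?_⟩
    simp only [mem_singleton]
    rintro k rfl k' rfl c d h1 h2
    simp only [sub_self] at h1 h2
    have hc2 : c ^ 2 = 2 * d ^ 2 := by linarith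
    have hcd : c * d = 0 := by linarith
    rcases mul_eq_zero.mp hcd with h | h
    · subst h
      exact ⟨rfl, by nlinarith⟩
    · subst h
      exact ⟨by nlinarith, rfl⟩
  | succ t ih =>
    obtain ⟨K, hcard, hKW, hK⟩ := ih
    obtain ⟨K', hcard', hKW', hK'⟩ := sqrtNegTwoSqDiffFree_step (9 ^ t) K hKW hK
    refine ⟨K', by rw [hcard', hcard]; ring, ?_, hK'⟩
    intro k hk
    have := hKW' k hk
    rw [pow_succ]
    constructor <;> linarith [this.1, this.2]

end Summit.MatrixMultiplication.MatrixMultiplication.Theorems.LevelOneGL2Designs.ParabolaLift
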